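import Summits.NavierStokesRegularity.NavierStokesRegularity.Theorems.ScenarioCensusRowF5lgSlice
import HarnessLib

/-!
# The tube-comparison method for the one-sided radial criterion reaches exactly the constants `C < 2`

Helper toward the crux `AxisymSwirlRegular` (stmt-NavierStokesRegularity-1964, route
TypeIIInviscidRelaxation), registered line `radial_inflow_split`, stub `stub_oneSidedRadialCriterion`
(⟨19059⟩ `OneSidedRadialCriterion`: `r u_r ≥ −Cν` on an axis tube for SOME `C` ⇒ continuation past `T`).

State of the tree.  The stub is reduced in kernel to its `C ≥ 2` half
(`ScenarioCensus.LogGate.oneSidedRadialCriterion_iff_geTwo`); the `C < 2` half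
(`ScenarioCensus.LogGate.oneSidedRadialCriterion_of_lt_two`) and the log gate
(`ScenarioCensus.LogGate.logGateCriterion_of`) are theorems, and BOTH are produced by one engine: the tube
comparison `ScenarioCensus.LogGate.tubeComparison_holds`, whose only analytic input is a TUBE BARRIER
`ScenarioCensus.LogGate.IsTubeBarrier δ₀ E w` for the inflow envelope `E` (`u_r ≥ −E(r)` on `0 < r ≤ δ₀`; at
`ν = 1` the stub's envelope is `E(r) = C/r`).

This file certifies, in kernel and BY NAME of that engine input, where the method stops:

* `rpow_isTubeBarrier_of_lt_two` — for `0 ≤ C < 2` the power `w(r) = r^{2−C}` IS a tube barrier for `E = C/r`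
  on every tube (it is an exact solution of `w″ − w′/r + (C/r)w′ = 0`);
* `not_isTubeBarrier_of_two_le` — for `C ≥ 2` there is NO tube barrier for `E = C/r` on any tube: a tube
  barrier is a positive `C²` supersolution of the Bessel(`C`) generator `w″ + (C−1)w′/r ≤ 0` on `(0,δ₀)` with
  `w(0⁺) = 0`, and for `C ≥ 2` the axis is an ENTRANCE boundary — `(r^{C−1}w′)′ ≤ 0` forces `w′ ≥ c/r` below a
  point of positive slope, so `w − c log r` is nondecreasing and `w(0⁺) = −∞`, not `0`
  (`entrance_noBarrier`, the general lemma);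
* `exists_isTubeBarrier_iff_lt_two` — the dichotomy `(∃ δ₀ > 0, ∃ w, IsTubeBarrier δ₀ (C/·) w) ↔ C < 2`
  (`0 ≤ C`).

Reading for the line: the open half `C ≥ 2` of ⟨19059⟩ is not reachable by ANY choice of barrier in the landed
comparison engine (nor, a fortiori, by the power/log barriers of print: Pan 2017, Zujin Zhang 2018, the log
gate); an attack on it must use more of the system than the swirl equation with a one-sided drift bound.
This is a method-tightness certificate, not a statement about the truth of the stub.

Adapted from the files-only κ-inflow skeleton of the ideator seat ns-idea-4
(`KappaInflow_v1_9.lean`, `noBarrierAtDimensionTwo`, there on the unit interval), generalised to an arbitrary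
tube radius and connected to the tree's `IsTubeBarrier`.

References: Q. S. Zhang, arXiv:2604.07785 (2026), §2 (one-dimensional comparison on the half line);
W. Feller, Ann. of Math. 55 (1952) (boundary classification; entrance boundary of the Bessel process of
dimension `≥ 2`). [folklore]
-/

noncomputable section

set_option linter.dupNamespace false

open Set Filter Topology
open Literature.Analysis.FluidPDE

namespace Summit.NavierStokesRegularity.NavierStokesRegularity.Theorems.RadialInflowBarrierWall

open Summit.NavierStokesRegularity.NavierStokesRegularity.Theorems.ScenarioCensus.LogGate

/-! ## §1 The entrance-boundary lemma -/

/-- **Entrance boundary of the Bessel(`M`) generator, `M ≥ 2`.** On an interval `(0, a)` there is no positive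
function `φ`, twice differentiable, with `φ″ + ((M−1)/r) φ′ ≤ 0` and `φ(0⁺) = 0`.  Proof: `φ` tends to `0 < φ`
at `0⁺`, so it is not antitone and has a point `r₀` of positive slope; `r ↦ r^{M−1}φ′(r)` is antitone
(its derivative is `r^{M−1}(φ″ + (M−1)φ′/r) ≤ 0`), so `φ′(r) ≥ c r^{1−M} ≥ c/r` for `r ≤ min(r₀,1)`
(`M − 1 ≥ 1`), whence `φ − c log` is nondecreasing there and `φ(r) ≤ φ(r₁) − c log(r₁/r) < 0` for small `r`,
contradicting positivity. [folklore] -/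
theorem entrance_noBarrier {M a : ℝ} (hM : 2 ≤ M) (ha : 0 < a) {φ φ' φ'' : ℝ → ℝ}
    (hφ : ∀ r ∈ Ioo 0 a, HasDerivAt φ (φ' r) r) (hφ' : ∀ r ∈ Ioo 0 a, HasDerivAt φ' (φ'' r) r)
    (hpos : ∀ r ∈ Ioo 0 a, 0 < φ r) (hsup : ∀ r ∈ Ioo 0 a, φ'' r + (M - 1) / r * φ' r ≤ 0) :
    ¬ Tendsto φ (𝓝[>] 0) (𝓝 0) := by
  intro hlim
  have hdiff : DifferentiableOn ℝ φ (Ioo 0 a) := fun r hr =>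
    (hφ r hr).differentiableAt.differentiableWithinAt
  have hderiv : ∀ r ∈ Ioo 0 a, deriv φ r = φ' r := fun r hr => (hφ r hr).deriv
  -- Step 1: a point with positive slope (else `φ` is antitone and cannot tend to `0` at `0⁺`).
  obtain ⟨r₀, hr₀, hφ'pos⟩ : ∃ r₀ ∈ Ioo 0 a, 0 < φ' r₀ := by
    by_contra hneg
    push Not at hneg
    have hanti : AntitoneOn φ (Ioo 0 a) :=
      antitoneOn_of_deriv_nonpos (convex_Ioo 0 a) hdiff.continuousOn (by rwa [interior_Ioo])
        (by
          intro r hr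
          rw [interior_Ioo] at hr
          rw [hderiv r hr]
          exact hneg r hr)
    have h12 : a / 2 ∈ Ioo 0 a := ⟨by positivity, by linarith⟩
    have hc : 0 < φ (a / 2) := hpos _ h12
    have hev : ∀ᶠ r in 𝓝[>] (0 : ℝ), φ r < φ (a / 2) / 2 := hlim (Iio_mem_nhds (by positivity))
    obtain ⟨δ, hδ, hsub⟩ := mem_nhdsGT_iff_exists_Ioo_subset.mp hev
    have hδ' : (0 : ℝ) < δ := hδ
    have hr0 : 0 < min (δ / 2) (a / 4) := lt_min (by linarith) (by positivity)
    have hrδ : min (δ / 2) (a / 4) < δ := by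
      have := min_le_left (δ / 2) (a / 4); linarith
    have hr12 : min (δ / 2) (a / 4) ≤ a / 2 := by
      have := min_le_right (δ / 2) (a / 4); linarith
    have h1 : φ (min (δ / 2) (a / 4)) < φ (a / 2) / 2 := hsub ⟨hr0, hrδ⟩
    have h2 : φ (a / 2) ≤ φ (min (δ / 2) (a / 4)) := hanti ⟨hr0, by linarith⟩ h12 hr12
    linarith
  -- Step 2: `g(r) = r^{M−1} φ'(r)` is antitone on `(0, a)`.
  set c := r₀ ^ (M - 1) * φ' r₀ with hc_def
  have hc : 0 < c := mul_pos (Real.rpow_pos_of_pos hr₀.1 _) hφ'pos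
  have hg : ∀ r ∈ Ioo 0 a, HasDerivAt (fun s => s ^ (M - 1) * φ' s)
      ((M - 1) * r ^ (M - 1 - 1) * φ' r + r ^ (M - 1) * φ'' r) r := by
    intro r hr
    have h1 : HasDerivAt (fun s : ℝ => s ^ (M - 1)) ((M - 1) * r ^ (M - 1 - 1)) r :=
      Real.hasDerivAt_rpow_const (Or.inl hr.1.ne')
    exact h1.mul (hφ' r hr)
  have hg_nonpos : ∀ r ∈ Ioo 0 a,
      (M - 1) * r ^ (M - 1 - 1) * φ' r + r ^ (M - 1) * φ'' r ≤ 0 := by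
    intro r hr
    have hsum := hsup r hr
    have hrpos := hr.1
    have heq : (M - 1) * r ^ (M - 1 - 1) * φ' r + r ^ (M - 1) * φ'' r
        = r ^ (M - 1) * (φ'' r + (M - 1) / r * φ' r) := by
      have h2 : r ^ (M - 1 - 1) = r ^ (M - 1) / r := by
        rw [Real.rpow_sub hrpos, Real.rpow_one]
      rw [h2]
      field_simp
      ring
    rw [heq]
    exact mul_nonpos_iff.mpr (Or.inl ⟨Real.rpow_nonneg hrpos.le _, hsum⟩)
  have hg_anti : AntitoneOn (fun s => s ^ (M - 1) * φ' s) (Ioo 0 a) := by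
    apply antitoneOn_of_deriv_nonpos (convex_Ioo 0 a)
    · exact fun r hr => (hg r hr).continuousAt.continuousWithinAt
    · rw [interior_Ioo]; exact fun r hr => (hg r hr).differentiableAt.differentiableWithinAt
    · rw [interior_Ioo]; intro r hr; rw [(hg r hr).deriv]; exact hg_nonpos r hr
  -- Step 3: `φ' ≥ c/r` on `(0, r₁]`, `r₁ = min r₀ 1` (as `r^{M−1} ≤ r` for `r ≤ 1`, `M ≥ 2`).
  set r₁ := min r₀ 1 with hr₁_def
  have hr₁pos : 0 < r₁ := lt_min hr₀.1 one_pos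
  have hr₁r₀ : r₁ ≤ r₀ := min_le_left _ _
  have hr₁1 : r₁ ≤ 1 := min_le_right _ _
  have hr₁a : r₁ < a := lt_of_le_of_lt hr₁r₀ hr₀.2
  have hφ'_lb : ∀ r ∈ Ioo 0 a, r ≤ r₁ → c / r ≤ φ' r := by
    intro r hr hrr
    have h1 : c ≤ r ^ (M - 1) * φ' r := hg_anti hr hr₀ (hrr.trans hr₁r₀)
    have h2 : r ^ (M - 1) ≤ r := by
      have := Real.rpow_le_rpow_of_exponent_ge hr.1 (hrr.trans hr₁1)
        (show (1 : ℝ) ≤ M - 1 by linarith)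
      simpa using this
    have h3 : 0 < φ' r := by
      by_contra hle
      push Not at hle
      have : r ^ (M - 1) * φ' r ≤ 0 :=
        mul_nonpos_iff.mpr (Or.inl ⟨Real.rpow_nonneg hr.1.le _, hle⟩)
      linarith
    have h4 : r ^ (M - 1) * φ' r ≤ r * φ' r := by gcongr
    rw [div_le_iff₀ hr.1]
    linarith
  -- Step 4: `φ − c log` is monotone on `(0, r₁]`.
  have hh : ∀ r ∈ Ioo 0 a,
      HasDerivAt (fun s => φ s - c * Real.log s) (φ' r - c * r⁻¹) r := by
    intro r hr
    exact (hφ r hr).sub ((Real.hasDerivAt_log hr.1.ne').const_mul c)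
  have hmono : MonotoneOn (fun s => φ s - c * Real.log s) (Ioc 0 r₁) := by
    apply monotoneOn_of_deriv_nonneg (convex_Ioc 0 r₁)
    · exact fun r hr =>
        (hh r ⟨hr.1, lt_of_le_of_lt hr.2 hr₁a⟩).continuousAt.continuousWithinAt
    · rw [interior_Ioc]
      exact fun r hr => (hh r ⟨hr.1, hr.2.trans hr₁a⟩).differentiableAt.differentiableWithinAt
    · rw [interior_Ioc]
      intro r hr
      rw [(hh r ⟨hr.1, hr.2.trans hr₁a⟩).deriv]
      have := hφ'_lb r ⟨hr.1, hr.2.trans hr₁a⟩ hr.2.le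
      rw [div_eq_mul_inv] at this
      linarith
  -- Step 5: at a sufficiently small radius `φ` would be negative.
  set A := φ r₁ - c * Real.log r₁ with hA
  set r := min (r₁ / 2) (Real.exp (-(|A| / c + 1))) with hr_def
  have hr0 : 0 < r := lt_min (by linarith) (Real.exp_pos _)
  have hrr₁ : r ≤ r₁ := by
    have := min_le_left (r₁ / 2) (Real.exp (-(|A| / c + 1))); linarith
  have hra : r < a := lt_of_le_of_lt hrr₁ hr₁a
  have hlog : Real.log r ≤ -(|A| / c + 1) := by
    have h1 : r ≤ Real.exp (-(|A| / c + 1)) := min_le_right _ _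
    have := Real.log_le_log hr0 h1
    rwa [Real.log_exp] at this
  have hmon : φ r - c * Real.log r ≤ φ r₁ - c * Real.log r₁ :=
    hmono ⟨hr0, hrr₁⟩ ⟨hr₁pos, le_rfl⟩ hrr₁
  have hφr : 0 < φ r := hpos r ⟨hr0, hra⟩
  have h6 : c * Real.log r ≤ c * (-(|A| / c + 1)) := by gcongr
  have h5 : c * (-(|A| / c + 1)) = -|A| - c := by
    field_simp
    ring
  have hAabs : A ≤ |A| := le_abs_self A
  rw [h5] at h6
  have hA' : φ r₁ - c * Real.log r₁ = A := rfl
  linarith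

/-! ## §2 No tube barrier for the envelope `C/r`, `C ≥ 2` -/

/-- A tube barrier is positive off the axis: the clause `r² ≤ K·w(r)` forces `w(r) > 0` for `0 < r ≤ δ₀`. -/
theorem isTubeBarrier_pos_of_pos {δ₀ : ℝ} {E w : ℝ → ℝ} (hw : IsTubeBarrier δ₀ E w) {r : ℝ} (hr : 0 < r)
    (hrδ : r ≤ δ₀) : 0 < w r := by
  obtain ⟨-, -, -, hδpos, ⟨K, hK⟩, -, -⟩ := hw
  have hδ : 0 < δ₀ := lt_of_lt_of_le hr hrδ
  -- the clause at `δ₀` (where `w δ₀ > 0`) forces `K > 0`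
  have hKδ := hK δ₀ ⟨hδ.le, le_rfl⟩
  have hKpos : 0 < K := by
    by_contra hK0
    push Not at hK0
    have : K * w δ₀ ≤ 0 := mul_nonpos_iff.mpr (Or.inr ⟨hK0, hδpos.le⟩)
    nlinarith
  -- the clause at `r`: `0 < r² ≤ K w r`
  have h := hK r ⟨hr.le, hrδ⟩
  have hr2 : 0 < r ^ 2 := by positivity
  by_contra hle
  push Not at hle
  have : K * w r ≤ 0 := mul_nonpos_iff.mpr (Or.inl ⟨hKpos.le, hle⟩)
  linarith

/-- A tube barrier tends to `0 = w 0` along `r → 0⁺` (continuity on `[0, δ₀]`). -/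
theorem isTubeBarrier_tendsto_zero {δ₀ : ℝ} {E w : ℝ → ℝ} (hw : IsTubeBarrier δ₀ E w) (hδ : 0 < δ₀) :
    Tendsto w (𝓝[>] 0) (𝓝 0) := by
  obtain ⟨-, hcont, h0, -, -, -, -⟩ := hw
  have h1 : ContinuousWithinAt w (Icc 0 δ₀) 0 := hcont 0 ⟨le_rfl, hδ.le⟩
  have h2 : Tendsto w (𝓝[Icc 0 δ₀] 0) (𝓝 (w 0)) := h1
  rw [h0] at h2
  have h3 : 𝓝[>] (0 : ℝ) = 𝓝[Ioo 0 δ₀] 0 := (nhdsWithin_Ioo_eq_nhdsGT hδ).symm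
  rw [h3]
  exact h2.mono_left (nhdsWithin_mono _ Ioo_subset_Icc_self)

/-- **No tube barrier at `C ≥ 2`.** For the inflow envelope `E(r) = C/r` with `C ≥ 2` (the `ν = 1` form of the
stub's hypothesis `r u_r ≥ −C`) the input type of the landed comparison engine `tubeComparison_holds` is EMPTY on
every tube: `¬ IsTubeBarrier δ₀ (fun r => C / r) w`.  The supersolution clause `w″ − w′/r + (C/r)w′ ≤ 0` is the
Bessel(`C`) inequality `w″ + (C−1)w′/r ≤ 0`, and `entrance_noBarrier` applies (`w > 0` off the axis by
`isTubeBarrier_pos_of_pos`, `w(0⁺) = 0` by `isTubeBarrier_tendsto_zero`). [folklore; method wall for ⟨19059⟩,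
`C ≥ 2`] -/
theorem not_isTubeBarrier_of_two_le {C δ₀ : ℝ} (hC : 2 ≤ C) (hδ : 0 < δ₀) (w : ℝ → ℝ) :
    ¬ IsTubeBarrier δ₀ (fun r => C / r) w := by
  intro hw
  have hpos : ∀ r ∈ Ioo 0 δ₀, 0 < w r := fun r hr => isTubeBarrier_pos_of_pos hw hr.1 hr.2.le
  have hlim := isTubeBarrier_tendsto_zero hw hδ
  obtain ⟨hC2, -, -, -, -, -, hsup⟩ := hw
  refine entrance_noBarrier (M := C) (φ := w) (φ' := deriv w) (φ'' := iteratedDeriv 2 w) hC hδ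
    (fun r hr => (SliceCalc.slice_derivs hC2 hr).1) (fun r hr => (SliceCalc.slice_derivs hC2 hr).2) hpos
    (fun r hr => ?_) hlim
  have h := hsup r hr
  have hr := hr.1
  have e : iteratedDeriv 2 w r - r⁻¹ * deriv w r + C / r * deriv w r
      = iteratedDeriv 2 w r + (C - 1) / r * deriv w r := by
    field_simp
    ring
  linarith [e]

/-! ## §3 The power barrier below the critical constant, and the dichotomy -/

/-- For `0 < r` the power `r^{2−C}` has derivative `(2−C) r^{1−C}`. -/
theorem hasDerivAt_rpow_two_sub {C r : ℝ} (hr : 0 < r) :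
    HasDerivAt (fun s : ℝ => s ^ (2 - C)) ((2 - C) * r ^ (1 - C)) r := by
  have h := Real.hasDerivAt_rpow_const (p := 2 - C) (Or.inl hr.ne')
  rwa [show 2 - C - 1 = 1 - C by ring] at h

/-- `deriv (r ↦ r^{2−C}) = (2−C) r^{1−C}` at positive points. -/
theorem deriv_rpow_two_sub {C r : ℝ} (hr : 0 < r) :
    deriv (fun s : ℝ => s ^ (2 - C)) r = (2 - C) * r ^ (1 - C) :=
  (hasDerivAt_rpow_two_sub hr).deriv

/-- `iteratedDeriv 2 (r ↦ r^{2−C}) = (2−C)(1−C) r^{−C}` at positive points. -/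
theorem iteratedDeriv_two_rpow_two_sub {C r : ℝ} (hr : 0 < r) :
    iteratedDeriv 2 (fun s : ℝ => s ^ (2 - C)) r = (2 - C) * (1 - C) * r ^ (-C) := by
  rw [show (2 : ℕ) = 1 + 1 from rfl, iteratedDeriv_succ, iteratedDeriv_one]
  have hev : deriv (fun s : ℝ => s ^ (2 - C)) =ᶠ[𝓝 r] fun s => (2 - C) * s ^ (1 - C) := by
    filter_upwards [Ioi_mem_nhds hr] with s hs using deriv_rpow_two_sub hs
  rw [hev.deriv_eq]
  have h := (Real.hasDerivAt_rpow_const (p := 1 - C) (Or.inl hr.ne')).const_mul (2 - C)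
  rw [show 1 - C - 1 = -C by ring] at h
  rw [h.deriv]
  ring

/-- **The power barrier below the critical constant.** For `0 ≤ C < 2` and every `δ₀ > 0`, `w(r) = r^{2−C}` is a
tube barrier for the envelope `E(r) = C/r` on `[0, δ₀]`: it is `C^∞` off the axis, continuous with `w(0) = 0`,
positive at `δ₀`, `r² = r^C · r^{2−C} ≤ δ₀^C w(r)`, nondecreasing, and an EXACT solution of
`w″ − w′/r + (C/r)w′ = (2−C) r^{−C}((1−C) − 1 + C) = 0`. (The barrier behind print's `C < 2`: Pan 2017, Zujin Zhang
2018; in the tree the `C < 2` criterion goes through the log gate instead.) [folklore] -/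
theorem rpow_isTubeBarrier_of_lt_two {C δ₀ : ℝ} (hC0 : 0 ≤ C) (hC : C < 2) (hδ : 0 < δ₀) :
    IsTubeBarrier δ₀ (fun r => C / r) (fun r => r ^ (2 - C)) := by
  have h2C : 0 < 2 - C := by linarith
  refine ⟨?_, ?_, ?_, ?_, ⟨δ₀ ^ C, ?_⟩, ?_, ?_⟩
  · -- `C²` on `(0, δ₀)`
    intro r hr
    exact (Real.contDiffAt_rpow_const_of_ne (p := 2 - C) hr.1.ne').contDiffWithinAt
  · exact (Real.continuous_rpow_const h2C.le).continuousOn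
  · exact Real.zero_rpow h2C.ne'
  · exact Real.rpow_pos_of_pos hδ _
  · intro r hr
    rcases eq_or_lt_of_le hr.1 with h0 | hrpos
    · subst h0
      show (0 : ℝ) ^ 2 ≤ δ₀ ^ C * ((0 : ℝ) ^ (2 - C))
      rw [Real.zero_rpow h2C.ne', mul_zero]
      norm_num
    · have h1 : r ^ (2 : ℝ) = r ^ C * r ^ (2 - C) := by
        rw [← Real.rpow_add hrpos]; ring_nf
      have h2 : r ^ C ≤ δ₀ ^ C := Real.rpow_le_rpow hr.1 hr.2 hC0
      have h3 : 0 ≤ r ^ (2 - C) := Real.rpow_nonneg hr.1 _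
      calc r ^ 2 = r ^ (2 : ℝ) := by norm_cast
        _ = r ^ C * r ^ (2 - C) := h1
        _ ≤ δ₀ ^ C * r ^ (2 - C) := mul_le_mul_of_nonneg_right h2 h3
  · intro r hr
    rw [deriv_rpow_two_sub hr.1]
    exact mul_nonneg h2C.le (Real.rpow_nonneg hr.1.le _)
  · intro r hr
    have hrpos := hr.1
    rw [iteratedDeriv_two_rpow_two_sub hrpos, deriv_rpow_two_sub hrpos]
    have h1 : r ^ (1 - C) = r ^ (-C) * r := by
      rw [show (1 : ℝ) - C = -C + 1 by ring, Real.rpow_add hrpos, Real.rpow_one]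
    rw [h1]
    have e : (2 - C) * (1 - C) * r ^ (-C) - r⁻¹ * ((2 - C) * (r ^ (-C) * r))
        + C / r * ((2 - C) * (r ^ (-C) * r)) = 0 := by
      field_simp
      ring
    rw [e]

/-- **Dichotomy: the tube-comparison method reaches exactly `C < 2`.** For `C ≥ 0`, a tube barrier for the
envelope `C/r` exists on some tube iff `C < 2` (`rpow_isTubeBarrier_of_lt_two` / `not_isTubeBarrier_of_two_le`).
Consequently the open half `C ≥ 2` of ⟨19059⟩ (`OneSidedRadialCriterionGeTwo`) has no proof through
`tubeComparison_holds`, whatever the barrier. [new; method-tightness certificate] -/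
theorem exists_isTubeBarrier_iff_lt_two {C : ℝ} (hC0 : 0 ≤ C) :
    (∃ δ₀ : ℝ, 0 < δ₀ ∧ ∃ w : ℝ → ℝ, IsTubeBarrier δ₀ (fun r => C / r) w) ↔ C < 2 := by
  constructor
  · rintro ⟨δ₀, hδ, w, hw⟩
    by_contra hC
    exact not_isTubeBarrier_of_two_le (not_lt.1 hC) hδ w hw
  · intro hC
    exact ⟨1, one_pos, _, rpow_isTubeBarrier_of_lt_two hC0 hC one_pos⟩

end Summit.NavierStokesRegularity.NavierStokesRegularity.Theorems.RadialInflowBarrierWall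

end
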